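import Literature.NumberTheory.EllipticCurves.ZpExtension
import HarnessLib

/-!
# `ℤ_p`-extensions: the kernel determines `κ : Γ_K ↠ ℤ_p` up to `ℤ_pˣ` (discharges)

D-0014 keeps `Literature/` sorry-free by stating cited results as named facts `def X : Prop`.
This sibling file of `Literature.NumberTheory.EllipticCurves.ZpExtension` (theorems only; it is
independent of any other `ZpExtension…Proofs` sibling) proves, from Mathlib alone, the two named
facts of that file concerning uniqueness of a `ℤ_p`-extension up to units:

* `Literature.ZpExtension.exists_eq_unitTwist_of_kerSubgroup_eq κ` : two `ℤ_p`-extensions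
  `κ, κ' : Γ_K ↠ ℤ_p` (`Literature.ZpExtension K p`) with `ker κ' = ker κ` differ by a unit twist,
  `κ' = κ.unitTwist u` for some `u : ℤ_[p]ˣ`;
* `Literature.NumberTheory.EllipticCurves.ZpExtension.IsCyclotomic.exists_eq_unitTwist` : in particular two *cyclotomic*
  `ℤ_p`-extensions of `K` (kernel `χ_p⁻¹(μ(ℤ_p))`) differ by a unit twist,

as `Literature.NumberTheory.EllipticCurves.ZpExtension.exists_eq_unitTwist_of_kerSubgroup_eq_holds` and
`Literature.NumberTheory.EllipticCurves.ZpExtension.IsCyclotomic.exists_eq_unitTwist_holds`; the second is the first fed to the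
accepted reduction `Literature.NumberTheory.EllipticCurves.ZpExtension.IsCyclotomic.exists_eq_unitTwist_of`.  Both facts are proved
exactly as vendored (same hypotheses; no discrepancy with the source was found).

## The source

L. C. Washington, *Introduction to Cyclotomic Fields*, GTM 83, 2nd ed. (Springer 1997), Ch. 13,
§13.1: a `ℤ_p`-extension of `K` is a Galois extension `K_∞/K` with `Gal(K_∞/K) ≃ ℤ_p`; the field
`K_∞` determines the isomorphism `Gal(K_∞/K) ≃ ℤ_p` only up to an automorphism of `ℤ_p`, and
`Aut(ℤ_p) = ℤ_pˣ`; the cyclotomic `ℤ_p`-extension is the unique `ℤ_p`-extension of `K` inside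
`K(μ_{p^∞})`.  In the choice-free avatar of `ZpExtension.lean` (`κ : Γ_K →ₜ* ℤ_p` surjective,
`K_∞ = K̄^{ker κ}`) this is precisely: `ker κ' = ker κ ⇒ κ' = u • κ` for a unit `u`.  (The book is
not held by the project library; the statement used is the registered named fact, whose cite is
`[cite: Washington1997, §13.1]`.)

## The proof (elementary; no continuity is used)

Let `ker κ' = ker κ`.  Choose `σ₀ ∈ Γ_K` with `κ σ₀ = 1` (surjectivity) and put `u := κ' σ₀ ∈ ℤ_p`.

1. `dvd_toAdd_of_kerSubgroup_le` : if `ker κ ≤ ker κ'` then `κ'(κ⁻¹(pⁿℤ_p)) ⊆ pⁿℤ_p`.  Indeed if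
   `κ τ = pⁿ b`, pick `ρ` with `κ ρ = b`; then `τ ρ^{-pⁿ} ∈ ker κ ≤ ker κ'`, so `κ' τ = pⁿ κ' ρ`.
2. For `σ ∈ Γ_K` and `n`, let `a ∈ ℕ` with `κ σ ≡ a (mod pⁿ)` (`PadicInt.appr`).  Then
   `κ (σ σ₀^{-a}) = κ σ - a ∈ pⁿℤ_p`, so by 1, `κ' σ - a u = κ' (σ σ₀^{-a}) ∈ pⁿℤ_p`, whence
   `κ' σ - u κ σ = (κ' σ - a u) - u (κ σ - a) ∈ pⁿℤ_p` for every `n`, i.e. `κ' σ = u κ σ`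
   (`PadicInt.ext_of_toZModPow`).
3. Surjectivity of `κ'` gives `τ₀` with `1 = κ' τ₀ = u κ τ₀`, so `u ∈ ℤ_pˣ`, and `κ' = κ.unitTwist u`.

(Equivalently: every abstract group endomorphism of `ℤ_p` preserves each `pⁿℤ_p`, hence is
continuous and `ℤ_p`-linear, so `End(ℤ_p) = ℤ_p` and `Aut(ℤ_p) = ℤ_pˣ`.)

## References

* [Washington1997] L. C. Washington, *Introduction to Cyclotomic Fields*, 2nd ed., GTM 83,
  Springer 1997, doi:10.1007/978-1-4612-1934-7, §13.1.
-/

noncomputable section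

universe u

namespace Literature.NumberTheory.EllipticCurves

namespace ZpExtension

open Field

variable {K : Type u} [Field K] {p : ℕ} [Fact p.Prime] (κ : ZpExtension K p)

variable {κ} in
/-- If `ker κ ≤ ker κ'` for two `ℤ_p`-extensions `κ, κ' : Γ_K ↠ ℤ_p`, then
`κ'(κ⁻¹(pⁿℤ_p)) ⊆ pⁿℤ_p`: if `κ τ = pⁿ b`, pick `ρ` with `κ ρ = b` (surjectivity of `κ`); then
`τ ρ^{-pⁿ} ∈ ker κ ≤ ker κ'`, so `κ' τ = pⁿ κ' ρ`.  Auxiliary step of the uniqueness-up-to-units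
statement of Washington, *Introduction to Cyclotomic Fields*, §13.1. [folklore] -/
lemma dvd_toAdd_of_kerSubgroup_le {κ' : ZpExtension K p} (h : κ.kerSubgroup ≤ κ'.kerSubgroup)
    (n : ℕ) {τ : absoluteGaloisGroup K} (hτ : (p : ℤ_[p]) ^ n ∣ (κ τ).toAdd) :
    (p : ℤ_[p]) ^ n ∣ (κ' τ).toAdd := by
  obtain ⟨b, hb⟩ := hτ
  obtain ⟨ρ, hρ⟩ := κ.surjective (Multiplicative.ofAdd b)
  rw [coe_toContinuousMonoidHom] at hρ
  have hmem : τ * (ρ ^ (p ^ n))⁻¹ ∈ κ.kerSubgroup := by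
    rw [mem_kerSubgroup, map_mul, map_inv, map_pow, mul_inv_eq_one, hρ]
    apply Multiplicative.toAdd.injective
    rw [hb, toAdd_pow, toAdd_ofAdd, nsmul_eq_mul, Nat.cast_pow]
  have hmem' := h hmem
  rw [mem_kerSubgroup, map_mul, map_inv, map_pow, mul_inv_eq_one] at hmem'
  refine ⟨(κ' ρ).toAdd, ?_⟩
  rw [hmem', toAdd_pow, nsmul_eq_mul, Nat.cast_pow]

/-- **Discharge of `Literature.NumberTheory.EllipticCurves.ZpExtension.exists_eq_unitTwist_of_kerSubgroup_eq`.**  Two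
`ℤ_p`-extensions `κ, κ' : Γ_K ↠ ℤ_p` with the same kernel differ by a unit twist:
`ker κ' = ker κ ⇒ ∃ u : ℤ_pˣ, κ' = κ.unitTwist u`.  Proof: with `κ σ₀ = 1` and `u := κ' σ₀`, for
every `σ` and `n` one has `κ' σ - u κ σ ∈ pⁿℤ_p` (approximate `κ σ` by `a ∈ ℕ` modulo `pⁿ` and apply
`dvd_toAdd_of_kerSubgroup_le` to `σ σ₀^{-a}`), so `κ' = u • κ`; surjectivity of `κ'` makes `u` a
unit.  This is the statement "`K_∞` determines `Gal(K_∞/K) ≃ ℤ_p` up to `Aut(ℤ_p) = ℤ_pˣ`" of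
Washington, *Introduction to Cyclotomic Fields* (2nd ed. 1997), §13.1, in the choice-free form of
`ZpExtension.lean`. [cite: Washington1997, §13.1] -/
theorem exists_eq_unitTwist_of_kerSubgroup_eq_holds : κ.exists_eq_unitTwist_of_kerSubgroup_eq := by
  intro κ' hker
  obtain ⟨σ₀, hσ₀⟩ := κ.surjective (Multiplicative.ofAdd 1)
  rw [coe_toContinuousMonoidHom] at hσ₀
  -- the candidate unit
  set u : ℤ_[p] := (κ' σ₀).toAdd with hu_def
  have key : ∀ σ, (κ' σ).toAdd = u * (κ σ).toAdd := by
    intro σ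
    refine PadicInt.ext_of_toZModPow.mp fun n => ?_
    rw [← sub_eq_zero, ← map_sub, ← RingHom.mem_ker, PadicInt.ker_toZModPow,
      Ideal.mem_span_singleton]
    set a : ℕ := (κ σ).toAdd.appr n with ha_def
    have ha : (p : ℤ_[p]) ^ n ∣ (κ σ).toAdd - a :=
      Ideal.mem_span_singleton.mp (PadicInt.appr_spec n _)
    have hτ : (p : ℤ_[p]) ^ n ∣ (κ (σ * (σ₀ ^ a)⁻¹)).toAdd := by
      rw [map_mul, map_inv, map_pow, toAdd_mul, toAdd_inv, toAdd_pow, hσ₀, toAdd_ofAdd,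
        nsmul_one, ← sub_eq_add_neg]
      exact ha
    have hτ' := κ.dvd_toAdd_of_kerSubgroup_le hker.symm.le n hτ
    rw [map_mul, map_inv, map_pow, toAdd_mul, toAdd_inv, toAdd_pow, nsmul_eq_mul] at hτ'
    have hrw : (κ' σ).toAdd - u * (κ σ).toAdd =
        ((κ' σ).toAdd + -((a : ℤ_[p]) * u)) - u * ((κ σ).toAdd - a) := by
      rw [hu_def]; ring
    rw [hrw]
    exact dvd_sub hτ' (dvd_mul_of_dvd_right ha u)
  -- `u` is a unit, by surjectivity of `κ'`
  obtain ⟨τ₀, hτ₀⟩ := κ'.surjective (Multiplicative.ofAdd 1)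
  rw [coe_toContinuousMonoidHom] at hτ₀
  have hu : IsUnit u := by
    refine IsUnit.of_mul_eq_one (κ τ₀).toAdd ?_
    rw [← key τ₀, hτ₀, toAdd_ofAdd]
  refine ⟨hu.unit, DFunLike.ext _ _ fun σ => ?_⟩
  rw [unitTwist_apply, IsUnit.unit_spec, ← key σ, ofAdd_toAdd]

variable {κ} in
/-- **Discharge of `Literature.NumberTheory.EllipticCurves.ZpExtension.IsCyclotomic.exists_eq_unitTwist`** (uniqueness of the
cyclotomic `ℤ_p`-extension up to `ℤ_pˣ`): two cyclotomic `κ, κ'` have the same kernel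
`χ_p⁻¹(μ(ℤ_p))`, so this is `exists_eq_unitTwist_of_kerSubgroup_eq_holds` fed to the accepted
reduction `IsCyclotomic.exists_eq_unitTwist_of`.
Ref: Washington, *Introduction to Cyclotomic Fields* (2nd ed. 1997), §13.1 (the cyclotomic
`ℤ_p`-extension is the unique `ℤ_p`-extension of `K` inside `K(μ_{p^∞})`; `Aut(ℤ_p) = ℤ_pˣ`).
[cite: Washington1997, §13.1] -/
theorem IsCyclotomic.exists_eq_unitTwist_holds : IsCyclotomic.exists_eq_unitTwist (κ := κ) :=
  IsCyclotomic.exists_eq_unitTwist_of κ.exists_eq_unitTwist_of_kerSubgroup_eq_holds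

end ZpExtension

end Literature.NumberTheory.EllipticCurves
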